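import Summits.Langlands.Langlands.Theorems.PhantomRMYoshidaResiduallyYoshidaLiftingCrossRegularDefs
import Literature.NumberTheory.Automorphic.AutomorphicRepsGLSatakeProofs
import Literature.NumberTheory.Automorphic.UnramifiedHeckeLevel
import HarnessLib

/-!
# Route `PhantomRMYoshida`, crux `ResiduallyYoshidaLifting` (stmt-Langlands-13639), line
# `cross-regular-annihilator-primes`: stub S3 `stub_crossLevelRaisingSeed` — its FREE parts, and the reduction
# of S3 to ×-type level raising for a member of a Hecke family

S3 (`stub_crossLevelRaisingSeed`, the level-raising SEED of the Khare–Thorne successive-approximation line;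
statements over the landed currency `Theorems/PhantomRMYoshidaResiduallyYoshidaLiftingCrossRegularDefs.lean`,
namespace `Summit.Langlands.Langlands.Cruxes.ResiduallyYoshidaLifting.CrossRegularAnnihilatorPrimes`): from the
automorphic (`Aut`), irreducible `ρ₀ : Γ_ℚ → GL₄(ℚ̄_p)` of the crux's shape `Sh` (symplectic-`ε⁻¹`, ordinary
`(0,0,1,1)`, residually `σ̄ ⊕ σ̄'` through `red : ℤ̄_p → k`), produce a base level `𝔫₀ ≠ 0` and an infinity
type `T₀` such that for every finite set `Q` of residually admissible places (`QGoodRes`: `v ∤ p𝔫₀`;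
`ρ₀, σ̄, σ̄'` unramified at `v`; `σ̄ ⊕ σ̄'(Frob_v)` cross-regular generic) there is a member `(π₁, ρ₁)` of the
Hecke family of level `K(𝔫₀ ∏_{v ∈ Q} v²)` and infinity type `T₀` (`Member`) which is of ×-type at every
`v ∈ Q` (`CrossType`: square-zero inertia, exact Frobenius shape `(X−a)(X−q_v a)(X−b)(X−q_v b)` with
`q_v² a b = 1`; on `GSp₄`: Klingen-new of Roberts–Schmidt type IIIa).

What is FREE (proved below from two proved Literature facts, no named open fact):
* `member_of_aut`: from `Aut hcpt ι ρ₀`, `Sh σ σ' red ρ₀` and the irreducibility of `ρ₀`, the pair `(π₀, ρ₀)`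
  is a `Member` at EVERY non-zero multiple `𝔫₀ M` of a base level `𝔫₀ ≠ 0`: the infinity type `T₀` is carried
  by `IsLAlgebraic`; a `K(𝔫₀)`-fixed form `φ ∈ W ∖ W'` exists by
  `AutomorphicRepData.exists_principalCongruenceLevel_fixed` (smoothness of `π₀` at the finite places); and
  `K(𝔫₀ M) ≤ K(𝔫₀)` is `principalCongruenceLevel_mono`.
* `crossType_inertia_of_isUnramifiedAt`: clause (i) of `CrossType` (square-zero inertia) at any place where the
  representation is unramified.
* `stub_crossLevelRaisingSeed_emptyQ` (registered sub-goal): S3 at `Q = ∅` — the seed is `(π₀, ρ₀)` itself, at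
  level `𝔫₀ · ∏_∅ v² = 𝔫₀`.

What is OPEN (NOT asserted here — it is the hypothesis, spelled out inline, of the reduction theorem
`stub_crossLevelRaisingSeed_of_crossLevelRaising`, a registered sub-goal): ×-TYPE LEVEL RAISING FOR A MEMBER.
For a member `(π₀, ρ₀)` of some level `𝔫 ≠ 0` and type `T` (`σ̄, σ̄'` irreducible, non-conjugate,
`det σ̄ = ε̄⁻¹ = det σ̄'`, `p` odd) there are `𝔫₀ ≠ 0`, `T₀` such that every finite set `Q` of residually
admissible places carries a member of level `K(𝔫₀ ∏_Q v²)` and type `T₀` which is of ×-type at each `v ∈ Q`;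
i.e. weight-(2,2)- and ordinarity-preserving, stable → stable, simultaneous Klingen-new level raising for
`GSp₄ → GL₄` at residually cross-regular generic places, with residually REDUCIBLE `ρ̄ = σ̄ ⊕ σ̄'`.  This is
OPEN IN PRINT.  Nearest published statements: Sorensen's level-raising congruences for automorphic forms on an
inner form of `GSp₄` compact at infinity (`π_∞ = 1`, i.e. weight (3,3); congruence of the fully degenerate
shape `diag(1, q, q², q³)`; output generic Klingen-spherical of type I, IIa or IIIa — type I, unramified, not
excluded) and its refinement for Saito–Kurokawa lifts; and the level-raising step of the Khare–Thorne method
for `GL₂` (a `J`-good `π` for every `J ⊆ Q`, by induction on `#J` via Ihara's lemma).  Neither the weight,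
nor the congruence shape, nor the group match the present statement.

So S3 = (×-type level raising for a member) ∘ `member_of_aut`: the registered S3 signature, verbatim, follows
from the inline hypothesis.  Nothing else is asserted.

References: C. M. Sorensen, *A generalization of level-raising congruences for algebraic modular forms*, Ann.
Inst. Fourier 56 (2006) [Sorensen2006, Thm. 4 and §8.3 Thm. 7 of arXiv:math/0504332]; C. M. Sorensen,
*Level-raising for Saito–Kurokawa forms*, Compos. Math. 145 (2009) [Sorensen2009, Thm. A]; J. Thorne,
*Automorphy of some residually dihedral Galois representations*, Math. Ann. 364 (2016) [Thorne2016, §4.8,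
Lemma 4.11]; A. Borel, H. Jacquet [BorelJacquet1979, 4.6].
-/

noncomputable section

set_option linter.dupNamespace false

open scoped Matrix Classical
open Filter

namespace Summit.Langlands.Langlands.Cruxes.ResiduallyYoshidaLifting.CrossRegularAnnihilatorPrimes

open Literature.NumberTheory.Automorphic Literature.NumberTheory.GaloisRepresentations
  IsDedekindDomain NumberField

section Free

variable {p : ℕ} [Fact p.Prime] {k : Type} [Field k] [TopologicalSpace k]

/-- **Free part of S3.** From `Aut hcpt ι ρ₀`, `Sh σ σ' red ρ₀` and the irreducibility of `ρ₀`, the pair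
`(π₀, ρ₀)` is a `Member` of the Hecke family of level `K(𝔫₀ M)` and infinity type `T₀` for EVERY `M ≠ 0`, for a
base level `𝔫₀ ≠ 0` and a type `T₀` depending only on `π₀`: `T₀` is the infinity type carried by
`IsLAlgebraic`, a `K(𝔫₀)`-fixed `φ ∈ W ∖ W'` is `AutomorphicRepData.exists_principalCongruenceLevel_fixed`, and
`K(𝔫₀ M) ≤ K(𝔫₀)` is `principalCongruenceLevel_mono`. [folklore] -/
theorem member_of_aut (red : Valued.integer (PadicAlgCl p) →+* k) (σ σ' : FramedGaloisRep ℚ k 2)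
    (hcpt : isCompact_glFiniteIntegralLevel 4 ℚ) (ι : PadicAlgCl p ≃+* ℂ)
    (ρ₀ : FramedGaloisRep ℚ (PadicAlgCl p) 4) (hirr : ρ₀.toGaloisRep.IsIrreducible)
    (hSh : Sh σ σ' red ρ₀) (hAut : Aut hcpt ι ρ₀) :
    ∃ (𝔫₀ : Ideal (𝓞 ℚ)) (T₀ : InfinityType ℚ 4) (π₀ : CuspidalAutomorphicRepData 4 ℚ hcpt), 𝔫₀ ≠ 0 ∧
      ∀ M : Ideal (𝓞 ℚ), M ≠ 0 → Member σ σ' red ι (𝔫₀ * M) T₀ π₀ ρ₀ := by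
  obtain ⟨π₀, hL, hmatch⟩ := hAut
  obtain ⟨T₀, hT₀, hT₀L⟩ := hL
  obtain ⟨𝔫₀, h𝔫₀, φ, hφW, hφW', hfix⟩ :=
    AutomorphicRepData.exists_principalCongruenceLevel_fixed π₀.1
  refine ⟨𝔫₀, T₀, π₀, h𝔫₀, fun M hM => ?_⟩
  exact ⟨⟨T₀, hT₀, hT₀L⟩, hT₀, ⟨φ, hφW, hφW', fun u hu =>
    hfix u (principalCongruenceLevel_mono 4 ℚ (mul_ne_zero h𝔫₀ hM) Ideal.mul_le_right hu)⟩,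
    hirr, hSh, hmatch⟩

/-- **Free: clause (i) of `CrossType`.** The square-zero inertia condition `(r(τ) − 1)² = 0` holds at any
place `v` where `r` is unramified (there `r(τ) = 1` on every inertia group above `v`). [folklore] -/
theorem crossType_inertia_of_isUnramifiedAt {v : HeightOneSpectrum (𝓞 ℚ)}
    {r : FramedGaloisRep ℚ (PadicAlgCl p) 4} (hr : r.IsUnramifiedAt v) :
    ∀ 𝔓 ∈ v.primesAbove, ∀ τ ∈ 𝔓.inertia (Field.absoluteGaloisGroup ℚ),
      ((r τ).val - 1) * ((r τ).val - 1) = 0 := by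
  intro 𝔓 h𝔓 τ hτ
  rw [hr 𝔓 h𝔓 τ hτ]
  simp

end Free

/-- **S3 at `Q = ∅` (free).** From `Aut hcpt ι ρ₀`, `Sh σ σ' red ρ₀` and the irreducibility of `ρ₀` alone
(no hypothesis on `p`, `k`, `σ̄`, `σ̄'`): there are `𝔫₀ ≠ 0` and `T₀` and a member `(π₁, ρ₁)` of level
`K(𝔫₀ · ∏_{v ∈ ∅} v²) = K(𝔫₀)` and type `T₀`, of ×-type at every `v ∈ ∅` — namely `(π₀, ρ₀)` itself
(`member_of_aut` with `M = 1`).  The conclusion is S3's conclusion at the empty auxiliary set. [folklore] -/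
theorem stub_crossLevelRaisingSeed_emptyQ :
    ∀ (p : ℕ) [Fact p.Prime] (k : Type) [Field k] [TopologicalSpace k] (red : Valued.integer (PadicAlgCl p) →+* k) (σ σ' : Literature.NumberTheory.GaloisRepresentations.FramedGaloisRep ℚ k 2) (hcpt : Literature.NumberTheory.Automorphic.isCompact_glFiniteIntegralLevel 4 ℚ) (ι : PadicAlgCl p ≃+* ℂ) (ρ₀ : Literature.NumberTheory.GaloisRepresentations.FramedGaloisRep ℚ (PadicAlgCl p) 4), ρ₀.toGaloisRep.IsIrreducible → Summit.Langlands.Langlands.Cruxes.ResiduallyYoshidaLifting.CrossRegularAnnihilatorPrimes.Sh σ σ' red ρ₀ → Summit.Langlands.Langlands.Cruxes.ResiduallyYoshidaLifting.CrossRegularAnnihilatorPrimes.Aut hcpt ι ρ₀ → ∃ (𝔫₀ : Ideal (NumberField.RingOfIntegers ℚ)) (T₀ : Literature.NumberTheory.Automorphic.InfinityType ℚ 4), 𝔫₀ ≠ 0 ∧ ∃ (π₁ : Literature.NumberTheory.Automorphic.CuspidalAutomorphicRepData 4 ℚ hcpt) (ρ₁ : Literature.NumberTheory.GaloisRepresentations.FramedGaloisRep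 ℚ (PadicAlgCl p) 4), Summit.Langlands.Langlands.Cruxes.ResiduallyYoshidaLifting.CrossRegularAnnihilatorPrimes.Member σ σ' red ι (𝔫₀ * (∅ : Finset (IsDedekindDomain.HeightOneSpectrum (NumberField.RingOfIntegers ℚ))).prod (fun v => v.asIdeal ^ 2)) T₀ π₁ ρ₁ ∧ ∀ v ∈ (∅ : Finset (IsDedekindDomain.HeightOneSpectrum (NumberField.RingOfIntegers ℚ))), Summit.Langlands.Langlands.Cruxes.ResiduallyYoshidaLifting.CrossRegularAnnihilatorPrimes.CrossType v ρ₁ := by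
  intro p _ k _ _ red σ σ' hcpt ι ρ₀ hirr hSh hAut
  obtain ⟨𝔫₀, T₀, π₀, h𝔫₀, hM⟩ := member_of_aut red σ σ' hcpt ι ρ₀ hirr hSh hAut
  exact ⟨𝔫₀, T₀, h𝔫₀, π₀, ρ₀, by simpa using hM 1 one_ne_zero, by simp⟩

/-- **S3 ⇐ ×-type level raising for a member (reduction; registered sub-goal of stmt-Langlands-13639).**  The
hypothesis, spelled out inline over the currency (`Member`, `QGoodRes`, `CrossType`, `DetCond`), is the
minimal missing statement: weight- and ordinarity-preserving, stable → stable, simultaneous ×-type (Klingen-new,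
IIIa) LEVEL RAISING at every finite set of residually cross-regular generic places for a member `(π₀, ρ₀)` of
some level `K(𝔫)`, `𝔫 ≠ 0`, and type `T` — OPEN IN PRINT in weight (2,2) with `ρ̄ = σ̄ ⊕ σ̄'` reducible
(nearest: Sorensen's `GSp₄` level raising for `π_∞ = 1` under `h ≡ diag(1,q,q²,q³)`, and Thorne's `GL₂`
simultaneous level raising, Lemma 4.11).  The conclusion is the registered S3 signature verbatim; the proof is
`member_of_aut` (the given automorphic `ρ₀` is a member at some level) followed by the hypothesis.
[cite: Sorensen2006, Thm. 4 and §8.3 Thm. 7 (arXiv:math/0504332 numbering)] [cite: Sorensen2009, Thm. A]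
[cite: Thorne2016, §4.8, Lemma 4.11 (the level-raising step of the Khare–Thorne method)] -/
theorem stub_crossLevelRaisingSeed_of_crossLevelRaising :
    (∀ (p : ℕ) [Fact p.Prime], p ≠ 2 → ∀ (k : Type) [Field k] [CharP k p] [IsAlgClosed k] [TopologicalSpace k] [DiscreteTopology k] (red : Valued.integer (PadicAlgCl p) →+* k) (σ σ' : Literature.NumberTheory.GaloisRepresentations.FramedGaloisRep ℚ k 2) (hcpt : Literature.NumberTheory.Automorphic.isCompact_glFiniteIntegralLevel 4 ℚ) (ι : PadicAlgCl p ≃+* ℂ) (𝔫 : Ideal (NumberField.RingOfIntegers ℚ)) (T : Literature.NumberTheory.Automorphic.InfinityType ℚ 4) (π₀ : Literature.NumberTheory.Automorphic.CuspidalAutomorphicRepData 4 ℚ hcpt) (ρ₀ : Literature.NumberTheory.GaloisRepresentations.FramedGaloisRep ℚ (PadicAlgCl p) 4), σ.toGaloisRep.IsIrreducible → σ'.toGaloisRep.IsIrreducible → Summit.Langlands.Langlands.Cruxes.ResiduallyYoshidaLifting.CrossRegularAnnihilatorPrimes.DetCond p σ σ' → (¬ ∃ g : GL (Fin 2) k,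 ∀ x, g * σ x * g⁻¹ = σ' x) → 𝔫 ≠ 0 → Summit.Langlands.Langlands.Cruxes.ResiduallyYoshidaLifting.CrossRegularAnnihilatorPrimes.Member σ σ' red ι 𝔫 T π₀ ρ₀ → ∃ (𝔫₀ : Ideal (NumberField.RingOfIntegers ℚ)) (T₀ : Literature.NumberTheory.Automorphic.InfinityType ℚ 4), 𝔫₀ ≠ 0 ∧ ∀ Q : Finset (IsDedekindDomain.HeightOneSpectrum (NumberField.RingOfIntegers ℚ)), (∀ v ∈ Q, Summit.Langlands.Langlands.Cruxes.ResiduallyYoshidaLifting.CrossRegularAnnihilatorPrimes.QGoodRes σ σ' 𝔫₀ ρ₀ v) → ∃ (π₁ : Literature.NumberTheory.Automorphic.CuspidalAutomorphicRepData 4 ℚ hcpt) (ρ₁ : Literature.NumberTheory.GaloisRepresentations.FramedGaloisRep ℚ (PadicAlgCl p) 4), Summit.Langlands.Langlands.Cruxes.ResiduallyYoshidaLifting.CrossRegularAnnihilatorPrimes.Member σ σ' red ι (𝔫₀ * Q.prod (fun v => v.asIdeal ^ 2)) T₀ π₁ ρ₁ ∧ ∀ v ∈ Q, Summit.Langlands.Langlands.Cruxes.ResiduallyYoshidaLifting.CrossRegularAnnihilatorPrimes.CrossType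 v ρ₁) → (∀ (p : ℕ) [Fact p.Prime], p ≠ 2 → ∀ (k : Type) [Field k] [CharP k p] [IsAlgClosed k] [TopologicalSpace k] [DiscreteTopology k] (red : Valued.integer (PadicAlgCl p) →+* k) (σ σ' : Literature.NumberTheory.GaloisRepresentations.FramedGaloisRep ℚ k 2) (hcpt : Literature.NumberTheory.Automorphic.isCompact_glFiniteIntegralLevel 4 ℚ) (ι : PadicAlgCl p ≃+* ℂ) (ρ₀ : Literature.NumberTheory.GaloisRepresentations.FramedGaloisRep ℚ (PadicAlgCl p) 4), σ.toGaloisRep.IsIrreducible → σ'.toGaloisRep.IsIrreducible → Summit.Langlands.Langlands.Cruxes.ResiduallyYoshidaLifting.CrossRegularAnnihilatorPrimes.DetCond p σ σ' → (¬ ∃ g : GL (Fin 2) k, ∀ x, g * σ x * g⁻¹ = σ' x) → ρ₀.toGaloisRep.IsIrreducible → Summit.Langlands.Langlands.Cruxes.ResiduallyYoshidaLifting.CrossRegularAnnihilatorPrimes.Sh σ σ' red ρ₀ → Summit.Langlands.Langlands.Cruxes.ResiduallyYoshidaLifting.CrossRegularAnnihilatorPrimes.Aut hcpt ι ρ₀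 → ∃ (𝔫₀ : Ideal (NumberField.RingOfIntegers ℚ)) (T₀ : Literature.NumberTheory.Automorphic.InfinityType ℚ 4), 𝔫₀ ≠ 0 ∧ ∀ Q : Finset (IsDedekindDomain.HeightOneSpectrum (NumberField.RingOfIntegers ℚ)), (∀ v ∈ Q, Summit.Langlands.Langlands.Cruxes.ResiduallyYoshidaLifting.CrossRegularAnnihilatorPrimes.QGoodRes σ σ' 𝔫₀ ρ₀ v) → ∃ (π₁ : Literature.NumberTheory.Automorphic.CuspidalAutomorphicRepData 4 ℚ hcpt) (ρ₁ : Literature.NumberTheory.GaloisRepresentations.FramedGaloisRep ℚ (PadicAlgCl p) 4), Summit.Langlands.Langlands.Cruxes.ResiduallyYoshidaLifting.CrossRegularAnnihilatorPrimes.Member σ σ' red ι (𝔫₀ * Q.prod (fun v => v.asIdeal ^ 2)) T₀ π₁ ρ₁ ∧ ∀ v ∈ Q, Summit.Langlands.Langlands.Cruxes.ResiduallyYoshidaLifting.CrossRegularAnnihilatorPrimes.CrossType v ρ₁) := by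
  intro H p _ hp k _ _ _ _ _ red σ σ' hcpt ι ρ₀ hσ hσ' hdet hnc hirr hSh hAut
  obtain ⟨𝔫, T, π₀, h𝔫, hM⟩ := member_of_aut red σ σ' hcpt ι ρ₀ hirr hSh hAut
  have hmem : Member σ σ' red ι 𝔫 T π₀ ρ₀ := by simpa using hM 1 one_ne_zero
  exact H p hp k red σ σ' hcpt ι 𝔫 T π₀ ρ₀ hσ hσ' hdet hnc h𝔫 hmem

end Summit.Langlands.Langlands.Cruxes.ResiduallyYoshidaLifting.CrossRegularAnnihilatorPrimes

end
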